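import Literature.RingTheory.CentralSimple.ReducedDegree
import Literature.RingTheory.CentralSimple.CentralizerCornerDimensions
import Literature.RingTheory.CentralSimple.MaximalEtaleIsMaximalCommutative
import Mathlib.Algebra.Central.End
import HarnessLib

/-!
# The reduced degree of the commutant of a simple subalgebra: `d · [C_B(L) : F]_red = deg B`
# (Milne, *Complex Multiplication*, Ch. I §3 Exercise 3.10 (a) — the algebra)

Family `hodge`, lane `lit-hodgefound` (Track 2 foundations library; skeleton seat `lit-hodgefound-skel-3`, generation 59,
row **A3-G143** «Milne CM Ex. 3.10 (a): complex multiplication relative to a simple subalgebra `L ⊆ End⁰`»), topic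
`Literature/RingTheory/CentralSimple`, namespace `Literature.RingTheory.CentralSimple`.  FILE 1 of the row: the pure
algebra.  Sequel, BY NAME (nothing restated), of `ReducedDegree` (A3-G141: `reducedDegree F B = [B : F]_red`, Milne CM
(1.2)–(1.3); §6 `reducedDegree_eq_mul_of_isCentral_isSimple`: `[B:F]_red = d·[K:F]` for `B` central simple of degree
`d` over a field `K ⊇ F`), of p11's `DoubleCentralizer` (Voight Prop. 7.7.8: `C_B(L)` is simple, `[L:F]·[C_B(L):F] =
[B:F]`, `C_B(C_B(L)) = L`) and `CentralizerCornerDimensions` (`isSquare_finrank_of_isCentral`), of p11's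
`SemisimpleCentralizer` (`isField_center`: the centre of a simple algebra is a field) and of p38's
`MaximalEtaleIsMaximalCommutative` (Bourbaki VIII §14 n°7 Prop. 4 a) `centralizer_eq_of_maximal_comm_isSemisimpleRing`
and Cor. 1 `exists_le_maximal_comm_isSemisimpleRing`).  THEOREMS ONLY (no definition, no instance, no named fact;
net debt 0, D-0026).

## The print

J. S. Milne, *Complex Multiplication* (course notes v0.10, 2020) [MilneCM2006], Ch. I §3, p. 29 (open text
`paper:url-8ccc30e4daab`, p0029), VERBATIM: «EXERCISE 3.10 Let `L` be a simple `ℚ`-algebra of finite degree `d²` over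
its centre `F`, and let `A` be an abelian variety containing `L` in its endomorphism algebra.  (a) Show that for any
semisimple commutative `ℚ`-subalgebra `R` of `End⁰_L(A)`, `dim_ℚ R ≤ (2 dim A)/d`, and that equality holds for some `R`
if and only [if] `A` has complex multiplication.  (b) Let `′` be a Rosati involution on `End⁰(A)` stabilizing `L`; show
that, if `A` has complex multiplication, then there is an `R` as in (a) that is stabilized by `′`.»  Here `End⁰_L(A)`
is the commutant of `L` in `End⁰(A)`, and «`A` has complex multiplication» is Def. 3.2 ∕ Prop. 3.3: «(a)
`[End⁰(A) : ℚ]_red = 2 dim A`; (b) `End⁰(A)` contains an étale subalgebra of degree `2 dim A` over `ℚ`» (pp. 27–28), with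
Prop. 3.1 «For any abelian variety `A`, `2 dim A ≥ [End⁰(A) : ℚ]_red`» proved through Prop. 1.2 «for any faithful
`B`-module `M`, `dim_k M ≥ [B : k]_red`» applied to `H₁(A, ℚ)`.  ((b), in the case `L = ℚ`, is the tree's row A3-G137,
`Geometry/Kaehler/ComplexTorusRosatiStableCMAlgebra`.)

## The algebra behind (a), formalised here (`F` a field; «semisimple commutative» = commutative REDUCED, as in every
## `reducedDegree` file of the tree — the same thing for finite-dimensional algebras over a perfect field)

Part (a) is a statement about the faithful `End⁰(A)`-module `V = H₁(A, ℚ)` (`dim V = 2 dim A`): `L ⊆ End⁰(A) ⊆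
End_ℚ(V) =: B`, a central simple algebra of degree `n = dim V`, and `End⁰_L(A) ⊆ C_B(L)`.  The three clauses follow from
three facts about a finite-dimensional SIMPLE algebra `C` with centre `K ⊇ F` — `C` is central simple over the field
`K`, say `[C : K] = c²` — proved in §1 by transporting the tree's central-simple theory along `F ⊆ K`:

* (A1) `[C : F] = c²·[K : F]` and `[C : F]_red = c·[K : F]` (`exists_finrank_eq_sq_mul_and_reducedDegree_eq`,
  `reducedDegree_sq_eq`: `[C:F]_red² = [C:F]·[K:F]`) — Milne's (1.2) `[Bᵢ : kᵢ]^{1/2}[kᵢ : k]` for one simple factor,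
  read intrinsically;
* (A2) for every commutative reduced `Z ⊆ C`, `[C_C(Z) : F]_red = [C : F]_red` (`reducedDegree_centralizer_eq_of_comm`):
  `Z` lies in a maximal commutative semisimple `K`-subalgebra of `C`, of degree `c` over `K` (Bourbaki VIII §14 n°7
  Cor. 1), which lies in `C_C(Z)` — «Prop. 4.1 for simple algebras»;
* (A3) a commutative reduced `R ⊆ C` of the top dimension `[R : F] = [C : F]_red` is its own commutant, `C_C(R) = R`
  (`centralizer_eq_self_of_finrank_eq_reducedDegree`; Bourbaki VIII §14 n°7 Prop. 4 a) over `K`).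

For a central simple `B` of degree `n` over `F` and a SIMPLE subalgebra `L ⊆ B` with centre `K = Z(L)`,
`[L : F] = d²·[K : F]`, the commutant `C = C_B(L)` is simple with `[L:F]·[C:F] = n²` and `Z(C) = C ∩ C_B(C) = C ∩ L =
Z(L)` (Voight 7.7.8), so (A1) gives

* (B1) **`d · [C_B(L) : F]_red = n`** (`mul_reducedDegree_centralizer_eq`) — with `n = 2 dim A` this is the bound
  `dim_ℚ R ≤ 2 dim A / d` of (a) for every commutative reduced `R ⊆ C_B(L)` (`mul_finrank_le_of_le_centralizer`), in
  particular for `R ⊆ End⁰_L(A)`;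
* (B2) for a commutative reduced `Z ⊆ B` commuting with `L`: **`d · [C_B(Z ∪ L) : F]_red = n`**
  (`mul_reducedDegree_centralizer_union_eq`, from (A2) in `C`) — used at torus level with `Z` the (semisimple part of
  the) commutant of `End⁰`, whose own commutant lies inside `End⁰`: «CM ⟹ equality for some `R`»;
* (B3) a commutative reduced `R ⊆ C_B(L)` with `d·[R : F] = n` satisfies **`C_B(R ∪ L) = R`**
  (`centralizer_union_eq_of_mul_finrank_eq`, from (A3) in `C`) — so an algebra `E ⊇ R ∪ L` (e.g. `End⁰(A)`) has a
  COMMUTATIVE commutant `C_B(E) ⊆ R`, which is Milne's Prop. 3.3 (c) «the centralizer of `End⁰(A)` in `End(H₁)` is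
  commutative» ⟺ (a) CM: «equality for some `R` ⟹ CM».

§4 specialises to `B = M_ι(F)` (`n = #ι`) and `B = End_F(V)` (`n = dim V`).  The torus-level and abelian-variety
statements of Ex. 3.10 (a) are FILES 2–3 of the row.  Characteristic `0` is assumed where the tree's §6 of
`ReducedDegree` (Pierce §10.7) is used; (B1)–(B3) hold verbatim over any perfect field.

## Mathlib / Literature search

Mathlib: no reduced degree; `Subalgebra.centralizer`, `Subalgebra.center`, `IsSimpleRing.isField_center`,
`Algebra.TensorProduct.lift`, `Subalgebra.restrictScalars`, `Algebra.IsCentral` for `Matrix`/`Module.End`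
(`Mathlib.Algebra.Central.End`).  Tree (`rg 'reducedDegree' lean/Literature`; `rg '3\.10'`): the reduced degree of a
commutant is known only for a COMMUTATIVE reduced algebra of operators (A3-G142 `ReducedDegreeCommutant`, Milne Prop. 4.1:
`reducedDegree_centralizer_eq_finrank`), i.e. the case `d = 1`, `L = K` a field acting on `V`; Ex. 3.10 (b) only for
`L = ℚ` (A3-G137).  Consumed BY NAME: `reducedDegree_eq_mul_of_isCentral_isSimple`, `finrank_le_reducedDegree`,
`reducedDegree_le_of_injective`, `reducedDegree_subalgebra_le`, `reducedDegree_eq_finrank_of_comm`,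
`reducedDegree_le_finrank_of_le_end`, `reducedDegree_matrix` (ReducedDegree); `isSimpleRing_centralizer`,
`finrank_mul_finrank_centralizer`, `centralizer_centralizer_eq` (DoubleCentralizer); `isSquare_finrank_of_isCentral`
(CentralizerCornerDimensions); `isField_center` (SemisimpleCentralizer); `exists_le_maximal_comm_isSemisimpleRing`,
`centralizer_eq_of_maximal_comm_isSemisimpleRing` (MaximalEtaleIsMaximalCommutative); `SimpleModule.isSemisimpleRing_baseChange`
(Pierce §10.7).

## References

* [MilneCM2006] J. S. Milne, *Complex Multiplication* (2006/2020), Ch. I §3 Exercise 3.10 (a) (p. 29); §1 (1.2)–(1.3),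
  Props. 1.2–1.3 (p. 9); §3 Prop. 3.1, Def. 3.2, Prop. 3.3 (pp. 27–28).
* [Voight2021] J. Voight, *Quaternion Algebras*, GTM 288 (2021), §7.7 Prop. 7.7.8 (a)(b)(c).
* [BourbakiAlgebreVIII2012] N. Bourbaki, *Algèbre* Ch. VIII (2012), §14 n°6 Prop. 3, n°7 Prop. 4 a) and Cor. 1
  (pp. A VIII.258–260).
* [Pierce1982] R. S. Pierce, *Associative Algebras* (1982), §10.7 Cor. b.
-/

noncomputable section

open Module
open scoped TensorProduct

namespace Literature.RingTheory.CentralSimple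

universe u v w

/-! ## §0 Plumbing -/

section Helpers

variable {R : Type*} [CommSemiring R] {A : Type*} [Semiring A] [Algebra R A]

/-- A subalgebra is reduced iff it contains no non-zero nilpotent element of the ambient algebra. [folklore] -/
private theorem isReduced_subalgebra_iff₃ (S : Subalgebra R A) :
    IsReduced S ↔ ∀ x ∈ S, IsNilpotent x → x = 0 := by
  constructor
  · rintro h x hx ⟨n, hn⟩
    have h0 : (⟨x, hx⟩ : S) = 0 :=
      h.eq_zero _ ⟨n, Subtype.ext (by rw [SubmonoidClass.coe_pow, ZeroMemClass.coe_zero]; exact hn)⟩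
    exact congrArg Subtype.val h0
  · intro h
    refine ⟨fun x hx => ?_⟩
    obtain ⟨n, hn⟩ := hx
    have h1 : (x : A) ^ n = 0 := by rw [← SubmonoidClass.coe_pow, hn, ZeroMemClass.coe_zero]
    exact Subtype.ext (by rw [ZeroMemClass.coe_zero]; exact h x x.2 ⟨n, h1⟩)

end Helpers

section HelpersRing

variable {R : Type*} [CommRing R] {A : Type*} [Ring A] [Algebra R A]

open scoped IsMulCommutative in
/-- A subalgebra which is a commutative semisimple ring is reduced (a nilpotent element lies in every maximal ideal,
and the Jacobson radical of a semisimple ring vanishes). [folklore] -/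
private theorem isReduced_of_isSemisimpleRing_of_comm (S : Subalgebra R A) [IsSemisimpleRing S]
    (hcomm : ∀ x ∈ S, ∀ y ∈ S, x * y = y * x) : IsReduced S := by
  haveI : IsMulCommutative S := ⟨⟨fun a b => Subtype.ext (hcomm a a.2 b b.2)⟩⟩
  refine ⟨fun x hx => ?_⟩
  obtain ⟨n, eq⟩ := hx
  exact (IsSemisimpleRing.jacobson_eq_bot ↥S).le <| Ideal.mem_sInf.mpr
    fun I hI => (Ideal.isMaximal_def.mpr hI).isPrime.mem_of_pow_mem n (eq ▸ I.zero_mem)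

end HelpersRing

/-! ## §1 A simple algebra over its centre: `[C:F] = c²[K:F]`, `[C:F]_red = c[K:F]`, commutants of commutative reduced
## subalgebras, self-centralizing subalgebras of top dimension -/

section OverCentre

variable {F : Type u} [Field F] {C : Type v} [Ring C] [Algebra F C] [IsSimpleRing C] [FiniteDimensional F C]

/-- The engine: everything of §1 proved in one context, in which `C` is regarded as a central simple algebra over the
field `K = Z(C)` (on top of the existing action `c • x = c x` of `K ⊆ C`; same carriers for `K`- and `F`-subalgebras).
[cite: MilneCM2006, Ch. I §1 (1.2)–(1.3), Prop. 1.3 (p. 9)] [cite: BourbakiAlgebreVIII2012, VIII §14 n°7 Prop. 4 a) and Cor. 1 (p. A VIII.260)] -/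
private theorem over_center [CharZero F] :
    ∃ c : ℕ, finrank F C = c ^ 2 * finrank F ↥(Subalgebra.center F C) ∧
      reducedDegree F C = c * finrank F ↥(Subalgebra.center F C) ∧
      (∀ Z : Subalgebra F C, (∀ x ∈ Z, ∀ y ∈ Z, x * y = y * x) → IsReduced Z →
        c * finrank F ↥(Subalgebra.center F C) ≤ reducedDegree F ↥(Subalgebra.centralizer F (Z : Set C))) ∧
      (∀ R : Subalgebra F C, (∀ x ∈ R, ∀ y ∈ R, x * y = y * x) → IsReduced R →
        finrank F R = c * finrank F ↥(Subalgebra.center F C) → Subalgebra.centralizer F (R : Set C) = R) := by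
  classical
  set K : Subalgebra F C := Subalgebra.center F C with hKdef
  letI : Field ↥K := (isField_center (F₀ := F) (A := C)).toField
  -- `C` as an algebra over its centre
  letI : Algebra ↥K C := Algebra.ofModule
    (fun c x y ↦ by rw [Subalgebra.smul_def, Subalgebra.smul_def, smul_eq_mul, smul_eq_mul, mul_assoc])
    (fun c x y ↦ by
      rw [Subalgebra.smul_def, Subalgebra.smul_def, smul_eq_mul, smul_eq_mul, ← mul_assoc,
        Subalgebra.mem_center_iff.1 c.2 x, mul_assoc])
  have halg : ∀ c : ↥K, algebraMap ↥K C c = (c : C) := fun c ↦ by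
    rw [Algebra.algebraMap_eq_smul_one, Subalgebra.smul_def, smul_eq_mul, mul_one]
  haveI : IsScalarTower F ↥K C := ⟨fun r c a ↦ by
    rw [Subalgebra.smul_def, Subalgebra.smul_def, Subalgebra.coe_smul, smul_eq_mul, smul_eq_mul,
      smul_mul_assoc]⟩
  haveI : Module.Finite ↥K C := Module.Finite.of_restrictScalars_finite F ↥K C
  haveI : Algebra.IsCentral ↥K C := ⟨fun z hz ↦ by
    rw [Subalgebra.mem_center_iff] at hz
    exact Algebra.mem_bot.2 ⟨⟨z, Subalgebra.mem_center_iff.2 hz⟩, halg _⟩⟩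
  -- the degree `c` of `C` over `K`
  obtain ⟨c, hc⟩ := isSquare_finrank_of_isCentral ↥K C
  have hc2 : finrank ↥K C = c ^ 2 := by rw [hc, sq]
  have hCF : finrank F C = c ^ 2 * finrank F ↥K := by
    rw [← Module.finrank_mul_finrank F ↥K C, hc2, mul_comm]
  have hred : reducedDegree F C = c * finrank F ↥K :=
    reducedDegree_eq_mul_of_isCentral_isSimple (F := F) (K := ↥K) (B := C) hc2
  -- every `K`-subalgebra restricts to an `F`-subalgebra with the same carrier and `[·:F] = [K:F]·[·:K]`
  have hres_dim : ∀ M : Subalgebra ↥K C, finrank F ↥(M.restrictScalars F) = finrank F ↥K * finrank ↥K ↥M :=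
    fun M ↦ by
      have h1 : finrank F ↥(M.restrictScalars F) = finrank F ↥M := rfl
      rw [h1, Module.finrank_mul_finrank F ↥K ↥M]
  have hres_comm : ∀ M : Subalgebra ↥K C, (∀ x ∈ M, ∀ y ∈ M, x * y = y * x) →
      ∀ x ∈ M.restrictScalars F, ∀ y ∈ M.restrictScalars F, x * y = y * x :=
    fun M hM x hx y hy ↦ hM x ((Subalgebra.mem_restrictScalars F).1 hx) y ((Subalgebra.mem_restrictScalars F).1 hy)
  have hres_red : ∀ M : Subalgebra ↥K C, (∀ x ∈ M, ∀ y ∈ M, x * y = y * x) → IsSemisimpleRing ↥M →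
      IsReduced ↥(M.restrictScalars F) := fun M hM hss ↦ by
    haveI := hss
    have hMred : IsReduced ↥M := isReduced_of_isSemisimpleRing_of_comm M hM
    rw [isReduced_subalgebra_iff₃] at hMred ⊢
    exact fun x hx hn ↦ hMred x ((Subalgebra.mem_restrictScalars F).1 hx) hn
  -- the compositum `K·Z` of a commutative reduced `F`-subalgebra `Z` with the centre, as a `K`-subalgebra: commutative,
  -- semisimple (characteristic `0`), containing `Z`
  have compositum : ∀ Z : Subalgebra F C, (∀ x ∈ Z, ∀ y ∈ Z, x * y = y * x) → IsReduced Z →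
      ∃ R : Subalgebra ↥K C, (∀ x ∈ R, ∀ y ∈ R, x * y = y * x) ∧ IsSemisimpleRing ↥R ∧ (∀ z ∈ Z, z ∈ R) := by
    intro Z hZcomm hZred
    letI : CommRing ↥Z := { (inferInstance : Ring ↥Z) with mul_comm := fun x y => Subtype.ext (hZcomm x x.2 y y.2) }
    haveI : IsArtinianRing ↥Z := IsArtinianRing.of_finite F ↥Z
    haveI : IsSemisimpleRing ↥Z := IsArtinianRing.isSemisimpleRing_of_isReduced ↥Z
    haveI : IsSemisimpleRing (↥K ⊗[F] ↥Z) := SimpleModule.isSemisimpleRing_baseChange F ↥Z ↥K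
    let φ : ↥K ⊗[F] ↥Z →ₐ[↥K] C :=
      Algebra.TensorProduct.lift (Algebra.ofId ↥K C) (Z.val : ↥Z →ₐ[F] C)
        fun a x => Algebra.commute_algebraMap_left a (x : C)
    refine ⟨φ.range, ?_, ?_, ?_⟩
    · rintro _ ⟨s, rfl⟩ _ ⟨t, rfl⟩
      rw [← map_mul, ← map_mul, mul_comm]
    · exact RingHom.isSemisimpleRing_of_surjective φ.rangeRestrict.toRingHom (AlgHom.rangeRestrict_surjective φ)
    · intro z hz
      refine ⟨(1 : ↥K) ⊗ₜ[F] (⟨z, hz⟩ : ↥Z), ?_⟩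
      change φ ((1 : ↥K) ⊗ₜ[F] (⟨z, hz⟩ : ↥Z)) = z
      rw [Algebra.TensorProduct.lift_tmul]
      change algebraMap ↥K C 1 * z = z
      rw [map_one, one_mul]
  refine ⟨c, hCF, hred, ?_, ?_⟩
  · -- (A2): `[C_C(Z) : F]_red ≥ c·[K:F]`
    intro Z hZcomm hZred
    obtain ⟨R, hRcomm, hRss, hZR⟩ := compositum Z hZcomm hZred
    haveI := hRss
    -- a maximal commutative semisimple `M ⊇ K·Z`, of degree `c` over `K` (Bourbaki VIII §14 n°7 Cor. 1)
    obtain ⟨M, hRM, hMss, hMmax, -, hMdim⟩ := exists_le_maximal_comm_isSemisimpleRing R hRcomm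
    have hMcomm : ∀ x ∈ M, ∀ y ∈ M, x * y = y * x := hMmax.prop
    have hMK : finrank ↥K ↥M = c := Nat.pow_left_injective two_ne_zero (by simpa [hc2] using hMdim)
    set MF : Subalgebra F C := M.restrictScalars F with hMFdef
    have hMFle : MF ≤ Subalgebra.centralizer F (Z : Set C) := fun m hm ↦ by
      rw [Subalgebra.mem_centralizer_iff]
      intro z hz
      exact hMcomm z (hRM (hZR z hz)) m ((Subalgebra.mem_restrictScalars F).1 hm)
    haveI : IsReduced ↥MF := hres_red M hMcomm hMss
    have hMFcomm' : ∀ x y : ↥MF, x * y = y * x := fun x y ↦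
      Subtype.ext (hres_comm M hMcomm x x.2 y y.2)
    have hdimMF : finrank F ↥MF = c * finrank F ↥K := by rw [hMFdef, hres_dim M, hMK, mul_comm]
    have h := reducedDegree_le_of_injective (Subalgebra.inclusion hMFle) (Subalgebra.inclusion_injective hMFle)
    rwa [reducedDegree_eq_finrank_of_comm (F := F) (B := ↥MF) hMFcomm', hdimMF] at h
  · -- (A3): a commutative reduced `R` with `[R:F] = c[K:F] = [C:F]_red` is its own commutant
    intro R hRcomm hRred hRdim
    obtain ⟨RK, hRKcomm, hRKss, hRRK⟩ := compositum R hRcomm hRred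
    haveI := hRKss
    -- `K·R = R` by maximality of the dimension
    set RKF : Subalgebra F C := RK.restrictScalars F with hRKFdef
    haveI : IsReduced ↥RKF := hres_red RK hRKcomm hRKss
    have hle : R ≤ RKF := fun r hr ↦ (Subalgebra.mem_restrictScalars F).2 (hRRK r hr)
    have hdimle : finrank F ↥RKF ≤ finrank F R := by
      rw [hRdim, ← hred]
      exact finrank_le_reducedDegree RKF (hres_comm RK hRKcomm)
    have hdimge : finrank F R ≤ finrank F ↥RKF := by
      rw [← Subalgebra.finrank_toSubmodule, ← Subalgebra.finrank_toSubmodule]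
      exact Submodule.finrank_mono (show Subalgebra.toSubmodule R ≤ Subalgebra.toSubmodule RKF from hle)
    have heq : R = RKF := Subalgebra.eq_of_le_of_finrank_eq hle (le_antisymm hdimge hdimle)
    have hmemRK : ∀ x : C, x ∈ RK ↔ x ∈ R := fun x ↦ by
      rw [heq, hRKFdef, Subalgebra.mem_restrictScalars]
    -- `RK` is maximal among commutative semisimple `K`-subalgebras
    have hmax : Maximal (fun M : Subalgebra ↥K C ↦ (∀ x ∈ M, ∀ y ∈ M, x * y = y * x) ∧ IsSemisimpleRing ↥M) RK := by
      refine ⟨⟨hRKcomm, hRKss⟩, fun M hM hRKM => ?_⟩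
      haveI := hM.2
      set MF : Subalgebra F C := M.restrictScalars F with hMFdef
      haveI : IsReduced ↥MF := hres_red M hM.1 hM.2
      have h1 : finrank F ↥MF ≤ finrank F R := by
        rw [hRdim, ← hred]
        exact finrank_le_reducedDegree MF (hres_comm M hM.1)
      have hle' : R ≤ MF := fun r hr ↦
        (Subalgebra.mem_restrictScalars F).2 (hRKM ((hmemRK r).2 hr))
      have h2 : finrank F R ≤ finrank F ↥MF := by
        rw [← Subalgebra.finrank_toSubmodule, ← Subalgebra.finrank_toSubmodule]
        exact Submodule.finrank_mono (show Subalgebra.toSubmodule R ≤ Subalgebra.toSubmodule MF from hle')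
      have heq' : R = MF := Subalgebra.eq_of_le_of_finrank_eq hle' (le_antisymm h2 h1)
      intro x hx
      have hx' : x ∈ R := by rw [heq', hMFdef, Subalgebra.mem_restrictScalars]; exact hx
      exact (hmemRK x).2 hx'
    have hcent := centralizer_eq_of_maximal_comm_isSemisimpleRing RK hmax
    -- transfer to `F`
    ext x
    rw [Subalgebra.mem_centralizer_iff]
    constructor
    · intro hx
      have hx' : x ∈ Subalgebra.centralizer ↥K (RK : Set C) := by
        rw [Subalgebra.mem_centralizer_iff]
        intro g hg
        exact hx g ((hmemRK g).1 hg)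
      rw [hcent] at hx'
      exact (hmemRK x).1 hx'
    · intro hx g hg
      exact hRcomm g hg x hx

/-- **(A1) A simple algebra over its centre: `[C : F] = c²·[Z(C) : F]` and `[C : F]_red = c·[Z(C) : F]`** for the
degree `c` of `C` over the field `Z(C)` — Milne's summand `[Bᵢ : kᵢ]^{1/2}[kᵢ : k]` of (1.2) for one simple factor,
with the centre read inside `C` (characteristic `0`). [cite: MilneCM2006, Ch. I §1 (1.2)–(1.3) and Prop. 1.3 (p. 9)] -/
theorem exists_finrank_eq_sq_mul_and_reducedDegree_eq [CharZero F] :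
    ∃ c : ℕ, finrank F C = c ^ 2 * finrank F ↥(Subalgebra.center F C) ∧
      reducedDegree F C = c * finrank F ↥(Subalgebra.center F C) := by
  obtain ⟨c, h1, h2, -, -⟩ := over_center (F := F) (C := C)
  exact ⟨c, h1, h2⟩

/-- **`[C : F]_red² = [C : F]·[Z(C) : F]`** for a finite-dimensional simple `F`-algebra `C` (characteristic `0`): the
square-root-free form of (A1). [cite: MilneCM2006, Ch. I §1 (1.2)–(1.3) (p. 9)] -/
theorem reducedDegree_sq_eq [CharZero F] :
    reducedDegree F C ^ 2 = finrank F C * finrank F ↥(Subalgebra.center F C) := by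
  obtain ⟨c, h1, h2⟩ := exists_finrank_eq_sq_mul_and_reducedDegree_eq (F := F) (C := C)
  rw [h2, h1]
  ring

/-- (A1) with the degree given: if `[C : F] = c²·[Z(C) : F]` then `[C : F]_red = c·[Z(C) : F]`.
[cite: MilneCM2006, Ch. I §1 (1.2)–(1.3) (p. 9)] -/
theorem reducedDegree_eq_mul_finrank_center [CharZero F] {c : ℕ}
    (hc : finrank F C = c ^ 2 * finrank F ↥(Subalgebra.center F C)) :
    reducedDegree F C = c * finrank F ↥(Subalgebra.center F C) := by
  obtain ⟨c', h1, h2⟩ := exists_finrank_eq_sq_mul_and_reducedDegree_eq (F := F) (C := C)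
  have hk : 0 < finrank F ↥(Subalgebra.center F C) := finrank_pos
  have hcc : c' = c := by
    have h := h1.symm.trans hc
    exact Nat.pow_left_injective two_ne_zero (Nat.eq_of_mul_eq_mul_right hk h)
  rw [h2, hcc]

/-- **(A2) «Prop. 4.1 for simple algebras»: the commutant of a commutative reduced subalgebra `Z` of a simple algebra
`C` has the full reduced degree, `[C_C(Z) : F]_red = [C : F]_red`** — `Z` lies in a maximal commutative semisimple
subalgebra of `C` over `Z(C)`, of degree `deg C` (Bourbaki VIII §14 n°7 Cor. 1), which lies in `C_C(Z)`
(characteristic `0`). [cite: BourbakiAlgebreVIII2012, VIII §14 n°7 Cor. 1 and n°6 Prop. 3 (pp. A VIII.258–260)]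
[cite: MilneCM2006, Ch. I §1 Prop. 1.3 (p. 9), §4 Prop. 4.1 (p. 34)] -/
theorem reducedDegree_centralizer_eq_of_comm [CharZero F] (Z : Subalgebra F C)
    (hcomm : ∀ x ∈ Z, ∀ y ∈ Z, x * y = y * x) [IsReduced Z] :
    reducedDegree F ↥(Subalgebra.centralizer F (Z : Set C)) = reducedDegree F C := by
  obtain ⟨c, -, h2, h3, -⟩ := over_center (F := F) (C := C)
  exact le_antisymm (reducedDegree_subalgebra_le _) (h2 ▸ h3 Z hcomm ‹_›)

/-- **(A3) A commutative reduced subalgebra of the top dimension `[R : F] = [C : F]_red` of a simple algebra `C` is its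
own commutant, `C_C(R) = R`** (it contains `Z(C)` and is a maximal commutative semisimple `Z(C)`-subalgebra, hence
maximal commutative: Bourbaki VIII §14 n°7 Prop. 4 a); characteristic `0`).
[cite: BourbakiAlgebreVIII2012, VIII §14 n°7 Prop. 4 a) (p. A VIII.260)] [cite: MilneCM2006, Ch. I §1 Prop. 1.3 (p. 9)] -/
theorem centralizer_eq_self_of_finrank_eq_reducedDegree [CharZero F] (R : Subalgebra F C)
    (hcomm : ∀ x ∈ R, ∀ y ∈ R, x * y = y * x) [IsReduced R] (hR : finrank F R = reducedDegree F C) :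
    Subalgebra.centralizer F (R : Set C) = R := by
  obtain ⟨c, -, h2, -, h4⟩ := over_center (F := F) (C := C)
  exact h4 R hcomm ‹_› (hR.trans h2)

end OverCentre

/-! ## §2 The commutant of a simple subalgebra of a central simple algebra: `d · [C_B(L) : F]_red = n` -/

section Centralizer

variable {F : Type u} [Field F] {B : Type v} [Ring B] [Algebra F B] [Algebra.IsCentral F B] [IsSimpleRing B]
  [FiniteDimensional F B]

/-- The centre of the commutant of a simple subalgebra `L` is the centre of `L`: `Z(C_B(L)) = C_B(L) ∩ C_B(C_B(L)) =
C_B(L) ∩ L = Z(L)` (Voight 7.7.8 (c)), as an `F`-linear isomorphism. [cite: Voight2021, §7.7 Prop. 7.7.8 (c)] -/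
private theorem nonempty_center_centralizer_linearEquiv (L : Subalgebra F B) [IsSimpleRing L] :
    Nonempty (↥(Subalgebra.center F ↥(Subalgebra.centralizer F (L : Set B))) ≃ₗ[F]
      ↥(Subalgebra.center F ↥L)) := by
  set C : Subalgebra F B := Subalgebra.centralizer F (L : Set B) with hCdef
  have hCC : Subalgebra.centralizer F (C : Set B) = L := centralizer_centralizer_eq L
  -- carriers
  have h1 : ∀ x : ↥(Subalgebra.center F ↥C), ((x : ↥C) : B) ∈ L ∧
      ∀ l ∈ L, l * ((x : ↥C) : B) = ((x : ↥C) : B) * l := by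
    intro x
    have hx := Subalgebra.mem_center_iff.1 x.2
    refine ⟨?_, fun l hl ↦ (Subalgebra.mem_centralizer_iff F).1 (x : ↥C).2 l hl⟩
    rw [← hCC, Subalgebra.mem_centralizer_iff]
    intro g hg
    exact congrArg Subtype.val (hx ⟨g, hg⟩)
  have h2 : ∀ y : ↥(Subalgebra.center F ↥L), ((y : ↥L) : B) ∈ C ∧
      ∀ g ∈ C, g * ((y : ↥L) : B) = ((y : ↥L) : B) * g := by
    intro y
    have hy := Subalgebra.mem_center_iff.1 y.2
    refine ⟨?_, fun g hg ↦ ((Subalgebra.mem_centralizer_iff F).1 hg _ (y : ↥L).2).symm⟩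
    rw [hCdef, Subalgebra.mem_centralizer_iff]
    intro l hl
    exact congrArg Subtype.val (hy ⟨l, hl⟩)
  refine ⟨{ toFun := fun x => ⟨⟨((x : ↥C) : B), (h1 x).1⟩, Subalgebra.mem_center_iff.2 fun l =>
              Subtype.ext ((h1 x).2 l l.2)⟩
            map_add' := fun x y => rfl
            map_smul' := fun r x => rfl
            invFun := fun y => ⟨⟨((y : ↥L) : B), (h2 y).1⟩, Subalgebra.mem_center_iff.2 fun g =>
              Subtype.ext ((h2 y).2 g g.2)⟩
            left_inv := fun x => rfl
            right_inv := fun y => rfl }⟩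

/-- **(B1) `d · [C_B(L) : F]_red = n`**: for a central simple `B` of degree `n` (`[B:F] = n²`) and a SIMPLE subalgebra
`L ⊆ B` of degree `d` over its centre (`[L:F] = d²·[Z(L):F]`), the commutant `C_B(L)` — a simple algebra with centre
`Z(L)` and `[L:F]·[C_B(L):F] = n²` (Voight 7.7.8) — has reduced degree `n/d`.  With `B = End(H₁(A,ℚ))`, `n = 2 dim A`,
this is the bound of Ex. 3.10 (a). [cite: MilneCM2006, Ch. I §3 Exercise 3.10 (a) (p. 29)]
[cite: Voight2021, §7.7 Prop. 7.7.8 (a)(b)(c)] -/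
theorem mul_reducedDegree_centralizer_eq [CharZero F] {n d : ℕ} (hn : finrank F B = n ^ 2) (L : Subalgebra F B)
    [IsSimpleRing L] (hd : finrank F L = d ^ 2 * finrank F ↥(Subalgebra.center F ↥L)) :
    d * reducedDegree F ↥(Subalgebra.centralizer F (L : Set B)) = n := by
  set C : Subalgebra F B := Subalgebra.centralizer F (L : Set B) with hCdef
  haveI : IsSimpleRing ↥C := isSimpleRing_centralizer L
  obtain ⟨c, hC, hCred⟩ := exists_finrank_eq_sq_mul_and_reducedDegree_eq (F := F) (C := ↥C)
  obtain ⟨e⟩ := nonempty_center_centralizer_linearEquiv (F := F) L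
  have hk : finrank F ↥(Subalgebra.center F ↥C) = finrank F ↥(Subalgebra.center F ↥L) := e.finrank_eq
  have hprod := finrank_mul_finrank_centralizer L
  rw [hn, hd, ← hCdef, hC, hk] at hprod
  -- `(d c k)² = n²`
  have hsq : (d * c * finrank F ↥(Subalgebra.center F ↥L)) ^ 2 = n ^ 2 := by rw [← hprod]; ring
  have h := Nat.pow_left_injective two_ne_zero hsq
  rw [hCred, hk, ← mul_assoc]
  exact h

/-- (B1) for a CENTRAL simple subalgebra: `[L:F] = d²` ⟹ `d · [C_B(L) : F]_red = n` (`C_B(L)` is then central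
simple of degree `n/d`). [cite: MilneCM2006, Ch. I §3 Exercise 3.10 (a) (p. 29)] [cite: Voight2021, §7.7 Prop. 7.7.8 (b)] -/
theorem mul_reducedDegree_centralizer_eq_of_isCentral [CharZero F] {n d : ℕ} (hn : finrank F B = n ^ 2)
    (L : Subalgebra F B) [IsSimpleRing L] [Algebra.IsCentral F ↥L] (hd : finrank F L = d ^ 2) :
    d * reducedDegree F ↥(Subalgebra.centralizer F (L : Set B)) = n := by
  refine mul_reducedDegree_centralizer_eq hn L ?_
  rw [hd, Algebra.IsCentral.center_eq_bot, Subalgebra.finrank_bot, mul_one]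

/-- **The bound of Ex. 3.10 (a): every commutative reduced `R` commuting with `L` has `d · [R : F] ≤ n`**
(`R ⊆ C_B(L)` and (B1)). [cite: MilneCM2006, Ch. I §3 Exercise 3.10 (a) (p. 29: «for any semisimple commutative `ℚ`-subalgebra `R` of `End⁰_L(A)`, `dim_ℚ R ≤ 2 dim A / d`»)] -/
theorem mul_finrank_le_of_le_centralizer [CharZero F] {n d : ℕ} (hn : finrank F B = n ^ 2) (L : Subalgebra F B)
    [IsSimpleRing L] (hd : finrank F L = d ^ 2 * finrank F ↥(Subalgebra.center F ↥L)) (R : Subalgebra F B)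
    (hRcomm : ∀ x ∈ R, ∀ y ∈ R, x * y = y * x) [hRred : IsReduced R]
    (hRL : R ≤ Subalgebra.centralizer F (L : Set B)) : d * finrank F R ≤ n := by
  set C : Subalgebra F B := Subalgebra.centralizer F (L : Set B) with hCdef
  -- `R` seen inside `C`
  set R' : Subalgebra F ↥C := R.comap C.val with hR'def
  have hmem : ∀ x : ↥C, x ∈ R' ↔ (x : B) ∈ R := fun x ↦ Subalgebra.mem_comap _ _ _
  have hR'comm : ∀ x ∈ R', ∀ y ∈ R', x * y = y * x := fun x hx y hy ↦
    Subtype.ext (hRcomm _ ((hmem x).1 hx) _ ((hmem y).1 hy))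
  haveI : IsReduced ↥R' := by
    rw [isReduced_subalgebra_iff₃] at hRred ⊢
    intro x hx hn'
    obtain ⟨m, hm⟩ := hn'
    exact Subtype.ext (hRred _ ((hmem x).1 hx) ⟨m, by rw [← SubmonoidClass.coe_pow, hm]; rfl⟩)
  have hdim : finrank F ↥R' = finrank F R := by
    let ψ : ↥R' →ₗ[F] ↥R :=
      { toFun := fun x => ⟨((x : ↥C) : B), (hmem x).1 x.2⟩
        map_add' := fun x y => rfl
        map_smul' := fun r x => rfl }
    have hψ : Function.Bijective ψ := by
      constructor
      · intro x y hxy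
        exact Subtype.ext (Subtype.ext (congrArg (fun z : ↥R => (z : B)) hxy))
      · intro y
        exact ⟨⟨⟨(y : B), hRL y.2⟩, (hmem _).2 y.2⟩, rfl⟩
    exact (LinearEquiv.ofBijective ψ hψ).finrank_eq
  have h := finrank_le_reducedDegree R' hR'comm
  rw [hdim] at h
  calc d * finrank F R ≤ d * reducedDegree F ↥C := Nat.mul_le_mul_left d h
    _ = n := mul_reducedDegree_centralizer_eq hn L hd

omit [Algebra.IsCentral F B] [IsSimpleRing B] [FiniteDimensional F B] in
/-- The commutant of a union is the intersection of the commutants. [folklore] -/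
private theorem centralizer_union_eq_inf (S T : Set B) :
    Subalgebra.centralizer F (S ∪ T) = Subalgebra.centralizer F S ⊓ Subalgebra.centralizer F T := by
  ext x
  rw [Algebra.mem_inf, Subalgebra.mem_centralizer_iff, Subalgebra.mem_centralizer_iff,
    Subalgebra.mem_centralizer_iff]
  constructor
  · intro h
    exact ⟨fun g hg => h g (Set.mem_union_left _ hg), fun g hg => h g (Set.mem_union_right _ hg)⟩
  · rintro ⟨h1, h2⟩ g (hg | hg)
    · exact h1 g hg
    · exact h2 g hg

/-- **(B2) `d · [C_B(Z ∪ L) : F]_red = n`** for a commutative reduced `Z ⊆ B` and a simple `L ⊆ C_B(Z)` of degree `d`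
over its centre: `C_B(Z ∪ L)` is the commutant, inside the simple algebra `C_B(L)`, of the commutative reduced `Z`, so
(A2) and (B1) apply.  (With `Z` the commutant of `End⁰(A)` of a CM abelian variety, whose own commutant is `End⁰(A)`,
this produces the `R ⊆ End⁰_L(A)` with `dim_ℚ R = 2 dim A / d` of Ex. 3.10 (a): «equality holds for some `R` if `A`
has complex multiplication».) [cite: MilneCM2006, Ch. I §3 Exercise 3.10 (a) (p. 29)]
[cite: BourbakiAlgebreVIII2012, VIII §14 n°7 Cor. 1 (p. A VIII.260)] -/
theorem mul_reducedDegree_centralizer_union_eq [CharZero F] {n d : ℕ} (hn : finrank F B = n ^ 2)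
    (Z : Subalgebra F B) (hZcomm : ∀ x ∈ Z, ∀ y ∈ Z, x * y = y * x) [hZred : IsReduced Z] (L : Subalgebra F B)
    [IsSimpleRing L] (hLZ : L ≤ Subalgebra.centralizer F (Z : Set B))
    (hd : finrank F L = d ^ 2 * finrank F ↥(Subalgebra.center F ↥L)) :
    d * reducedDegree F ↥(Subalgebra.centralizer F ((Z : Set B) ∪ (L : Set B))) = n := by
  set C : Subalgebra F B := Subalgebra.centralizer F (L : Set B) with hCdef
  haveI : IsSimpleRing ↥C := isSimpleRing_centralizer L
  have hZC : Z ≤ C := fun z hz ↦ by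
    rw [hCdef, Subalgebra.mem_centralizer_iff]
    intro l hl
    exact ((Subalgebra.mem_centralizer_iff F).1 (hLZ hl) z hz).symm
  -- `Z` seen inside `C`
  set Z' : Subalgebra F ↥C := Z.comap C.val with hZ'def
  have hmem : ∀ x : ↥C, x ∈ Z' ↔ (x : B) ∈ Z := fun x ↦ Subalgebra.mem_comap _ _ _
  have hZ'comm : ∀ x ∈ Z', ∀ y ∈ Z', x * y = y * x := fun x hx y hy ↦
    Subtype.ext (hZcomm _ ((hmem x).1 hx) _ ((hmem y).1 hy))
  haveI : IsReduced ↥Z' := by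
    rw [isReduced_subalgebra_iff₃] at hZred ⊢
    intro x hx hn'
    obtain ⟨m, hm⟩ := hn'
    exact Subtype.ext (hZred _ ((hmem x).1 hx) ⟨m, by rw [← SubmonoidClass.coe_pow, hm]; rfl⟩)
  -- the commutant of `Z'` in `C` is `C_B(Z ∪ L)`, along the inclusion `C ⊆ B`
  set T : Subalgebra F B := Subalgebra.centralizer F ((Z : Set B) ∪ (L : Set B)) with hTdef
  have hTC : T ≤ C := by
    rw [hTdef, centralizer_union_eq_inf]
    exact inf_le_right
  have hT : ∀ x : ↥C, x ∈ Subalgebra.centralizer F (Z' : Set ↥C) ↔ (x : B) ∈ T := by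
    intro x
    rw [Subalgebra.mem_centralizer_iff, hTdef, centralizer_union_eq_inf, Algebra.mem_inf]
    constructor
    · intro h
      refine ⟨?_, x.2⟩
      rw [Subalgebra.mem_centralizer_iff]
      intro z hz
      exact congrArg Subtype.val (h ⟨z, hZC hz⟩ ((hmem _).2 hz))
    · rintro ⟨h1, -⟩ g hg
      exact Subtype.ext ((Subalgebra.mem_centralizer_iff F).1 h1 (g : B) ((hmem g).1 hg))
  -- the two reduced degrees agree
  let f : ↥(Subalgebra.centralizer F (Z' : Set ↥C)) →ₐ[F] ↥T :=
    { toFun := fun x => ⟨((x : ↥C) : B), (hT x).1 x.2⟩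
      map_one' := rfl
      map_mul' := fun x y => rfl
      map_zero' := rfl
      map_add' := fun x y => rfl
      commutes' := fun r => rfl }
  have hf : Function.Injective f := fun x y hxy ↦
    Subtype.ext (Subtype.ext (congrArg (fun z : ↥T => (z : B)) hxy))
  let g : ↥T →ₐ[F] ↥(Subalgebra.centralizer F (Z' : Set ↥C)) :=
    { toFun := fun y => ⟨⟨(y : B), hTC y.2⟩, (hT _).2 y.2⟩
      map_one' := rfl
      map_mul' := fun x y => rfl
      map_zero' := rfl
      map_add' := fun x y => rfl
      commutes' := fun r => rfl }
  have hg : Function.Injective g := fun x y hxy ↦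
    Subtype.ext (congrArg (fun z : ↥(Subalgebra.centralizer F (Z' : Set ↥C)) => ((z : ↥C) : B)) hxy)
  have heq : reducedDegree F ↥T = reducedDegree F ↥(Subalgebra.centralizer F (Z' : Set ↥C)) :=
    le_antisymm (reducedDegree_le_of_injective g hg) (reducedDegree_le_of_injective f hf)
  rw [heq, reducedDegree_centralizer_eq_of_comm Z' hZ'comm]
  exact mul_reducedDegree_centralizer_eq hn L hd

/-- **(B3) A commutative reduced `R ⊆ C_B(L)` of the top dimension `d·[R : F] = n` satisfies `C_B(R ∪ L) = R`** (by
(A3) in the simple algebra `C_B(L)`).  Hence any algebra `E ⊇ R ∪ L` — e.g. `E = End⁰(A) ⊇ L` with `R ⊆ End⁰_L(A)` —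
has a COMMUTATIVE commutant `C_B(E) ⊆ R`: Milne's Prop. 3.3 (c) ⟺ (a), «equality for some `R` only if `A` has complex
multiplication». [cite: MilneCM2006, Ch. I §3 Exercise 3.10 (a) (p. 29), Prop. 3.3 (c) (p. 27)]
[cite: BourbakiAlgebreVIII2012, VIII §14 n°7 Prop. 4 a) (p. A VIII.260)] -/
theorem centralizer_union_eq_of_mul_finrank_eq [CharZero F] {n d : ℕ} (hn : finrank F B = n ^ 2)
    (L : Subalgebra F B) [IsSimpleRing L] (hd : finrank F L = d ^ 2 * finrank F ↥(Subalgebra.center F ↥L))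
    (R : Subalgebra F B) (hRcomm : ∀ x ∈ R, ∀ y ∈ R, x * y = y * x) [hRred : IsReduced R]
    (hRL : R ≤ Subalgebra.centralizer F (L : Set B)) (hR : d * finrank F R = n) :
    Subalgebra.centralizer F ((R : Set B) ∪ (L : Set B)) = R := by
  set C : Subalgebra F B := Subalgebra.centralizer F (L : Set B) with hCdef
  haveI : IsSimpleRing ↥C := isSimpleRing_centralizer L
  set R' : Subalgebra F ↥C := R.comap C.val with hR'def
  have hmem : ∀ x : ↥C, x ∈ R' ↔ (x : B) ∈ R := fun x ↦ Subalgebra.mem_comap _ _ _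
  have hR'comm : ∀ x ∈ R', ∀ y ∈ R', x * y = y * x := fun x hx y hy ↦
    Subtype.ext (hRcomm _ ((hmem x).1 hx) _ ((hmem y).1 hy))
  haveI : IsReduced ↥R' := by
    rw [isReduced_subalgebra_iff₃] at hRred ⊢
    intro x hx hn'
    obtain ⟨m, hm⟩ := hn'
    exact Subtype.ext (hRred _ ((hmem x).1 hx) ⟨m, by rw [← SubmonoidClass.coe_pow, hm]; rfl⟩)
  have hdim : finrank F ↥R' = finrank F R := by
    let ψ : ↥R' →ₗ[F] ↥R :=
      { toFun := fun x => ⟨((x : ↥C) : B), (hmem x).1 x.2⟩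
        map_add' := fun x y => rfl
        map_smul' := fun r x => rfl }
    have hψ : Function.Bijective ψ := by
      constructor
      · intro x y hxy
        exact Subtype.ext (Subtype.ext (congrArg (fun z : ↥R => (z : B)) hxy))
      · intro y
        exact ⟨⟨⟨(y : B), hRL y.2⟩, (hmem _).2 y.2⟩, rfl⟩
    exact (LinearEquiv.ofBijective ψ hψ).finrank_eq
  -- `[R' : F] = [C : F]_red`
  have hCred := mul_reducedDegree_centralizer_eq hn L hd
  have hd0 : d ≠ 0 := by
    rintro rfl
    rw [zero_mul] at hR
    rw [← hR, pow_two, mul_zero] at hn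
    exact (finrank_pos (R := F) (M := B)).ne' hn
  have hR'dim : finrank F ↥R' = reducedDegree F ↥C := by
    apply Nat.eq_of_mul_eq_mul_left (Nat.pos_of_ne_zero hd0)
    rw [hdim, hR, hCdef]
    exact hCred.symm
  have hcent := centralizer_eq_self_of_finrank_eq_reducedDegree R' hR'comm hR'dim
  -- transfer to `B`
  ext x
  rw [centralizer_union_eq_inf, Algebra.mem_inf]
  constructor
  · rintro ⟨h1, h2⟩
    have hx : (⟨x, h2⟩ : ↥C) ∈ Subalgebra.centralizer F (R' : Set ↥C) := by
      rw [Subalgebra.mem_centralizer_iff]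
      intro g hg
      exact Subtype.ext ((Subalgebra.mem_centralizer_iff F).1 h1 (g : B) ((hmem g).1 hg))
    rw [hcent] at hx
    exact (hmem _).1 hx
  · intro hx
    refine ⟨?_, hRL hx⟩
    rw [Subalgebra.mem_centralizer_iff]
    intro g hg
    exact hRcomm g hg x hx

/-- (B3), the form used: an algebra `E` containing `L` and a commutative reduced `R ⊆ C_B(L)` with `d·[R : F] = n` has a
commutative commutant (`C_B(E) ⊆ C_B(R ∪ L) = R`). [cite: MilneCM2006, Ch. I §3 Exercise 3.10 (a) (p. 29), Prop. 3.3 (c) (p. 27)] -/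
theorem centralizer_comm_of_mul_finrank_eq [CharZero F] {n d : ℕ} (hn : finrank F B = n ^ 2)
    (L : Subalgebra F B) [IsSimpleRing L] (hd : finrank F L = d ^ 2 * finrank F ↥(Subalgebra.center F ↥L))
    (R : Subalgebra F B) (hRcomm : ∀ x ∈ R, ∀ y ∈ R, x * y = y * x) [IsReduced R]
    (hRL : R ≤ Subalgebra.centralizer F (L : Set B)) (hR : d * finrank F R = n)
    (E : Subalgebra F B) (hLE : L ≤ E) (hRE : R ≤ E) :
    Subalgebra.centralizer F (E : Set B) ≤ R ∧
      ∀ x ∈ Subalgebra.centralizer F (E : Set B), ∀ y ∈ Subalgebra.centralizer F (E : Set B), x * y = y * x := by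
  have hle : Subalgebra.centralizer F (E : Set B) ≤ R := by
    rw [← centralizer_union_eq_of_mul_finrank_eq hn L hd R hRcomm hRL hR]
    exact Subalgebra.centralizer_le F _ _ (Set.union_subset (fun x hx => hRE hx) (fun x hx => hLE hx))
  exact ⟨hle, fun x hx y hy => hRcomm x (hle hx) y (hle hy)⟩

end Centralizer

/-! ## §3 Matrix algebras (`n = #ι`) and `End_F(V)` (`n = dim V`) -/

section MatrixForms

variable {F : Type u} [Field F] [CharZero F] {ι : Type w} [Fintype ι] [DecidableEq ι] [Nonempty ι]

omit [CharZero F] [DecidableEq ι] [Nonempty ι] in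
/-- `[M_ι(F) : F] = #ι²`. [folklore] -/
private theorem finrank_matrix_eq_sq : finrank F (Matrix ι ι F) = Fintype.card ι ^ 2 := by
  rw [Module.finrank_matrix, Module.finrank_self, mul_one, sq]

/-- **Ex. 3.10 (a), the bound, for matrices**: for a simple `L ⊆ M_ι(F)` of degree `d` over its centre, every
commutative reduced `R ⊆ M_ι(F)` commuting with `L` has `d · dim_F R ≤ #ι`, and `d · [C(L) : F]_red = #ι`.
[cite: MilneCM2006, Ch. I §3 Exercise 3.10 (a) (p. 29)] -/
theorem Matrix.mul_reducedDegree_centralizer_eq_card (L : Subalgebra F (Matrix ι ι F)) [IsSimpleRing L] {d : ℕ}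
    (hd : finrank F L = d ^ 2 * finrank F ↥(Subalgebra.center F ↥L)) :
    d * reducedDegree F ↥(Subalgebra.centralizer F (L : Set (Matrix ι ι F))) = Fintype.card ι :=
  mul_reducedDegree_centralizer_eq finrank_matrix_eq_sq L hd

/-- Matrix form of `mul_finrank_le_of_le_centralizer`. [cite: MilneCM2006, Ch. I §3 Exercise 3.10 (a) (p. 29)] -/
theorem Matrix.mul_finrank_le_card_of_le_centralizer (L : Subalgebra F (Matrix ι ι F)) [IsSimpleRing L] {d : ℕ}
    (hd : finrank F L = d ^ 2 * finrank F ↥(Subalgebra.center F ↥L)) (R : Subalgebra F (Matrix ι ι F))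
    (hRcomm : ∀ x ∈ R, ∀ y ∈ R, x * y = y * x) [IsReduced R]
    (hRL : R ≤ Subalgebra.centralizer F (L : Set (Matrix ι ι F))) : d * finrank F R ≤ Fintype.card ι :=
  mul_finrank_le_of_le_centralizer finrank_matrix_eq_sq L hd R hRcomm hRL

/-- Matrix form of (B2). [cite: MilneCM2006, Ch. I §3 Exercise 3.10 (a) (p. 29)] -/
theorem Matrix.mul_reducedDegree_centralizer_union_eq_card (Z : Subalgebra F (Matrix ι ι F))
    (hZcomm : ∀ x ∈ Z, ∀ y ∈ Z, x * y = y * x) [IsReduced Z] (L : Subalgebra F (Matrix ι ι F)) [IsSimpleRing L]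
    (hLZ : L ≤ Subalgebra.centralizer F (Z : Set (Matrix ι ι F))) {d : ℕ}
    (hd : finrank F L = d ^ 2 * finrank F ↥(Subalgebra.center F ↥L)) :
    d * reducedDegree F ↥(Subalgebra.centralizer F ((Z : Set (Matrix ι ι F)) ∪ (L : Set (Matrix ι ι F)))) =
      Fintype.card ι :=
  mul_reducedDegree_centralizer_union_eq finrank_matrix_eq_sq Z hZcomm L hLZ hd

/-- Matrix form of (B3). [cite: MilneCM2006, Ch. I §3 Exercise 3.10 (a) (p. 29), Prop. 3.3 (c) (p. 27)] -/
theorem Matrix.centralizer_union_eq_of_mul_finrank_eq_card (L : Subalgebra F (Matrix ι ι F)) [IsSimpleRing L]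
    {d : ℕ} (hd : finrank F L = d ^ 2 * finrank F ↥(Subalgebra.center F ↥L)) (R : Subalgebra F (Matrix ι ι F))
    (hRcomm : ∀ x ∈ R, ∀ y ∈ R, x * y = y * x) [IsReduced R]
    (hRL : R ≤ Subalgebra.centralizer F (L : Set (Matrix ι ι F))) (hR : d * finrank F R = Fintype.card ι) :
    Subalgebra.centralizer F ((R : Set (Matrix ι ι F)) ∪ (L : Set (Matrix ι ι F))) = R :=
  centralizer_union_eq_of_mul_finrank_eq finrank_matrix_eq_sq L hd R hRcomm hRL hR

/-- Matrix form of `centralizer_comm_of_mul_finrank_eq`: an algebra `E ⊆ M_ι(F)` containing `L` and a commutative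
reduced `R ⊆ C(L)` with `d · dim R = #ι` has a commutative commutant, contained in `R`.
[cite: MilneCM2006, Ch. I §3 Exercise 3.10 (a) (p. 29), Prop. 3.3 (c) (p. 27)] -/
theorem Matrix.centralizer_comm_of_mul_finrank_eq_card (L : Subalgebra F (Matrix ι ι F)) [IsSimpleRing L]
    {d : ℕ} (hd : finrank F L = d ^ 2 * finrank F ↥(Subalgebra.center F ↥L)) (R : Subalgebra F (Matrix ι ι F))
    (hRcomm : ∀ x ∈ R, ∀ y ∈ R, x * y = y * x) [IsReduced R]
    (hRL : R ≤ Subalgebra.centralizer F (L : Set (Matrix ι ι F))) (hR : d * finrank F R = Fintype.card ι)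
    (E : Subalgebra F (Matrix ι ι F)) (hLE : L ≤ E) (hRE : R ≤ E) :
    Subalgebra.centralizer F (E : Set (Matrix ι ι F)) ≤ R ∧
      ∀ x ∈ Subalgebra.centralizer F (E : Set (Matrix ι ι F)),
        ∀ y ∈ Subalgebra.centralizer F (E : Set (Matrix ι ι F)), x * y = y * x :=
  centralizer_comm_of_mul_finrank_eq finrank_matrix_eq_sq L hd R hRcomm hRL hR E hLE hRE

end MatrixForms

section EndForms

variable {F : Type u} [Field F] [CharZero F] {V : Type v} [AddCommGroup V] [Module F V] [FiniteDimensional F V]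
  [Nontrivial V]

omit [CharZero F] in
/-- `End_F(V)` is simple for `V ≠ 0`. [folklore] -/
private theorem isSimpleRing_moduleEnd : IsSimpleRing (Module.End F V) := by
  have hn : 0 < finrank F V := finrank_pos
  haveI : Nonempty (Fin (finrank F V)) := ⟨⟨0, hn⟩⟩
  exact IsSimpleRing.of_ringEquiv (LinearMap.toMatrixAlgEquiv (Module.finBasis F V)).symm.toRingEquiv inferInstance

omit [CharZero F] [Nontrivial V] in
/-- `[End_F(V) : F] = (dim_F V)²`. [folklore] -/
private theorem finrank_moduleEnd_eq_sq : finrank F (Module.End F V) = finrank F V ^ 2 := by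
  rw [Module.finrank_linearMap, sq]

/-- **Ex. 3.10 (a), the bound, for a simple algebra of operators**: for a simple `L ⊆ End_F(V)` of degree `d` over
its centre, `d · [C(L) : F]_red = dim_F V`. [cite: MilneCM2006, Ch. I §3 Exercise 3.10 (a) (p. 29)] -/
theorem End.mul_reducedDegree_centralizer_eq_finrank (L : Subalgebra F (Module.End F V)) [IsSimpleRing L] {d : ℕ}
    (hd : finrank F L = d ^ 2 * finrank F ↥(Subalgebra.center F ↥L)) :
    d * reducedDegree F ↥(Subalgebra.centralizer F (L : Set (Module.End F V))) = finrank F V := by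
  haveI : IsSimpleRing (Module.End F V) := isSimpleRing_moduleEnd
  exact mul_reducedDegree_centralizer_eq finrank_moduleEnd_eq_sq L hd

/-- `End_F(V)` form of `mul_finrank_le_of_le_centralizer`: a commutative reduced `R` commuting with `L` has
`d · dim_F R ≤ dim_F V`. [cite: MilneCM2006, Ch. I §3 Exercise 3.10 (a) (p. 29)] -/
theorem End.mul_finrank_le_finrank_of_le_centralizer (L : Subalgebra F (Module.End F V)) [IsSimpleRing L] {d : ℕ}
    (hd : finrank F L = d ^ 2 * finrank F ↥(Subalgebra.center F ↥L)) (R : Subalgebra F (Module.End F V))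
    (hRcomm : ∀ x ∈ R, ∀ y ∈ R, x * y = y * x) [IsReduced R]
    (hRL : R ≤ Subalgebra.centralizer F (L : Set (Module.End F V))) : d * finrank F R ≤ finrank F V := by
  haveI : IsSimpleRing (Module.End F V) := isSimpleRing_moduleEnd
  exact mul_finrank_le_of_le_centralizer finrank_moduleEnd_eq_sq L hd R hRcomm hRL

/-- `End_F(V)` form of (B2). [cite: MilneCM2006, Ch. I §3 Exercise 3.10 (a) (p. 29)] -/
theorem End.mul_reducedDegree_centralizer_union_eq_finrank (Z : Subalgebra F (Module.End F V))
    (hZcomm : ∀ x ∈ Z, ∀ y ∈ Z, x * y = y * x) [IsReduced Z] (L : Subalgebra F (Module.End F V)) [IsSimpleRing L]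
    (hLZ : L ≤ Subalgebra.centralizer F (Z : Set (Module.End F V))) {d : ℕ}
    (hd : finrank F L = d ^ 2 * finrank F ↥(Subalgebra.center F ↥L)) :
    d * reducedDegree F ↥(Subalgebra.centralizer F ((Z : Set (Module.End F V)) ∪ (L : Set (Module.End F V)))) =
      finrank F V := by
  haveI : IsSimpleRing (Module.End F V) := isSimpleRing_moduleEnd
  exact mul_reducedDegree_centralizer_union_eq finrank_moduleEnd_eq_sq Z hZcomm L hLZ hd

/-- `End_F(V)` form of (B3). [cite: MilneCM2006, Ch. I §3 Exercise 3.10 (a) (p. 29), Prop. 3.3 (c) (p. 27)] -/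
theorem End.centralizer_union_eq_of_mul_finrank_eq_finrank (L : Subalgebra F (Module.End F V)) [IsSimpleRing L]
    {d : ℕ} (hd : finrank F L = d ^ 2 * finrank F ↥(Subalgebra.center F ↥L)) (R : Subalgebra F (Module.End F V))
    (hRcomm : ∀ x ∈ R, ∀ y ∈ R, x * y = y * x) [IsReduced R]
    (hRL : R ≤ Subalgebra.centralizer F (L : Set (Module.End F V))) (hR : d * finrank F R = finrank F V) :
    Subalgebra.centralizer F ((R : Set (Module.End F V)) ∪ (L : Set (Module.End F V))) = R := by
  haveI : IsSimpleRing (Module.End F V) := isSimpleRing_moduleEnd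
  exact centralizer_union_eq_of_mul_finrank_eq finrank_moduleEnd_eq_sq L hd R hRcomm hRL hR

end EndForms

end Literature.RingTheory.CentralSimple

end
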